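import Summits.BirchSwinnertonDyer.BirchSwinnertonDyer.Theorems.KimAtThreeDeepUpperOffStratumManinFree
import Literature.NumberTheory.EllipticCurves.Rank1Residual.Typed.WuthrichUpperBound
import HarnessLib

/-!
# Route `KimAtThreeKolyvagin` (rung W2), crux `DeepUpperAtThreeOffKatoStratum` (item 19562): the whole
# NON-ADDITIVE stratum from Wuthrich 2014 Prop. 21 (Kato's bound) by name — `stub_nonAdditive`
# VERBATIM modulo the deep Tamagawa-defect bound alone; the crux BY NAME from four facts + (U′) + (DD)

Cell `bsd-addord`, seat `bsd-addord-w2-c5` (gen 0), item `stmt-BirchSwinnertonDyer-19562`.  Sequel of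
`KimAtThreeDeepUpperNonAdditiveRows` / `KimAtThreeDeepUpperOffStratumManinFree` (this seat).  Theorems
only; every printed input is a hypothesis BY NAME; nothing asserted; the crux stays open.

THE POINT.  For the UPPER direction the `3`-part of BSD is more than needed: Miller's upper half
`MissingUpperBoundAt W 3` (`ord₃ #Ш ≤ ord₃ #Ш_an`) is Kato's Euler-system bound, IN PRINT at every odd
NON-ADDITIVE prime with surjective (or Borel) mod-`p` image in analytic rank `0` — Wuthrich 2014
Prop. 21 (tree fact `Wuthrich2014.sha_dvd_analyticSha`, consumer `Typed.missingUpperBoundAt_of_wuthrich`).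
Under the `3`-adic tower `ρ̄_{E,3}` is onto, so (U) of the previous file is DISCHARGED on ALL non-additive
rows — good ordinary, good SUPERSINGULAR, multiplicative with or WITHOUT (ram) — by ONE fact (+ GZK,
modularity), with no Yan–Zhu / Skinner main conjecture.  With the Manin-free bridge
(`sha_add_tamagawa_le_kuriharaPartial_zero_of_missingUpperBoundAt_of_optimal`):

* `missingUpperBoundAt_three_of_not_addv_of_towerSurj` — (U) on every non-additive tower row of analytic
  rank `0`;
* ★ `stub_nonAdditive_of_wuthrich_of_deepInfty_le_tamagawa` — the registered stub `stub_nonAdditive`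
  VERBATIM from Wuthrich Prop. 21 (`hW`), GZK (`hGZK`), modularity (`hmod`) and (DD) at the row ALONE:
  on the non-additive stratum the item's ENTIRE printed-fact debt is paid and its residual is exactly
  (DD) `∂^{(∞)}_{deep}(δ̃) ≤ v₃(∏ c_ℓ)` (by `KimAtThreeDeepUpperNonAdditiveRows` also necessary wherever
  `BSD₃` is known);
* ★ `deepUpperAtThreeOffKatoStratum_of_wuthrich_of_kato_of_residuals` — the crux BY NAME from FOUR named
  facts (Wuthrich 2014 Prop. 21, Kato Thm. 14.5 (3) Tamagawa-exact, GZK, modularity) and the residuals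
  (U′) = Miller's upper half on the additive POTENTIALLY-MULTIPLICATIVE tower rows of analytic rank `0`
  (the one sub-stratum with no printed `Ш`-bound in the tree: Wuthrich's constant `C` is supported at
  additive primes, Kato 14.5 (3) is typed for potentially good reduction, Kim–Nakamura 2020 gives the unit
  slice only) and (DD) on the crux's rows.
TYPED OBSTRUCTION OF ITEM 19562, final form: (DD) everywhere + (U′) on additive pot-mult rows.
[cite: Wuthrich2014, Prop. 21 (p. 400)] [cite: Kato2004Asterisque, Thm. 14.5 (3) (p. 236), Prop. 14.16 (2) (p. 244)]
[cite: Miller2011LMS, Def. 1.1] [cite: Kim2022StructureSelmer, §1.5.1, Conj. 1.10 (PDF pp. 7–8)]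
[cite: KimNakamura2020, Thm. 1.7] [cite: Kim2025RefinedTNC, Thm. 1.1]
-/

set_option autoImplicit false
-- the Theorems namespace of a single-conjunct summit repeats the summit name by design (D-0017)
set_option linter.dupNamespace false

noncomputable section

open scoped MatrixGroups ModularForm Classical

open CongruenceSubgroup WeierstrassCurve Literature.NumberTheory.EllipticCurves
  Literature.NumberTheory.EllipticCurves.ModularForms
  Literature.NumberTheory.EllipticCurves.Rank1Residual
  Literature.NumberTheory.EllipticCurves.Rank1Residual.Typed
  Literature.NumberTheory.EllipticCurves.Wuthrich2014

namespace Summit.BirchSwinnertonDyer.BirchSwinnertonDyer.Theorems.KimAtThreeDeepUpperOffStratumWuthrich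

open Summit.BirchSwinnertonDyer.Rank1Residual
open Summit.BirchSwinnertonDyer.BirchSwinnertonDyer.Theses.KimAtThreeKolyvagin
open Summit.BirchSwinnertonDyer.BirchSwinnertonDyer.Theorems.KimAtThreeDeepLowerNonAdditiveRows
open Summit.BirchSwinnertonDyer.BirchSwinnertonDyer.Theorems.KimAtThreeDeepUpperOffStratumManinFree

/-- **(U) on EVERY non-additive tower row of analytic rank `0`**: `MissingUpperBoundAt W 3` from
Wuthrich 2014 Prop. 21 (`hW` = `sha_dvd_analyticSha`: `#Ш ∣ C·#Ш_an` with `C` supported at `2`, additive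
primes and exotic-image primes), GZK (`hGZK`), modularity (`hmod`): `3` is good or multiplicative, hence
not additive for the `ℤ₃`-minimal model, and `ρ̄_{E,3}` is onto under the tower.
[cite: Wuthrich2014, Prop. 21 (p. 400)] [cite: Miller2011LMS, Def. 1.1] -/
theorem missingUpperBoundAt_three_of_not_addv_of_towerSurj (hW : sha_dvd_analyticSha)
    (hGZK : rank_eq_analyticRank_of_analyticRank_le_one) (hmod : hasEntireLFunction_rat)
    (W : WeierstrassCurve ℚ) [W.IsElliptic] [W.IsGloballyMinimal]
    (htower : ∀ n : ℕ, W.HasSurjectiveModNGaloisRep (3 ^ n : ℕ)) (hr0 : W.analyticRank = 0)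
    (hnA : ¬ (haveI : Fact (Nat.Prime 3) := ⟨Nat.prime_three⟩; Addv W 3)) :
    MissingUpperBoundAt W 3 := by
  haveI : Fact (Nat.Prime 3) := ⟨Nat.prime_three⟩
  have hsurj : W.HasSurjectiveModNGaloisRep 3 := by
    have h := htower 1
    rw [pow_one] at h
    exact h
  have hadd : ¬ ((W.baseChange ℚ_[3]).minimal ℤ_[3]).HasAdditiveReduction ℤ_[3] := by
    unfold Addv at hnA
    by_cases hgood : W.HasGoodReductionAtPrime 3
    · exact WeierstrassCurve.HasGoodReduction.not_hasAdditiveReduction (R := ℤ_[3]) hgood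
    · have hmult : W.HasMultiplicativeReductionAtPrime 3 := by
        by_contra h
        exact hnA ⟨hgood, h⟩
      exact WeierstrassCurve.HasMultiplicativeReduction.not_hasAdditiveReduction (R := ℤ_[3]) hmult
  exact Typed.missingUpperBoundAt_of_wuthrich W 3 hW hGZK hmod (by norm_num) hr0 hadd (Or.inr hsurj)

/-- ★ **The registered stub `stub_nonAdditive` of crux 19562, VERBATIM, from Wuthrich 2014 Prop. 21
(`hW`), GZK (`hGZK`), modularity (`hmod`) and the deep Tamagawa-defect bound (DD) at the row ALONE.**
Road: (U) at the row (previous theorem) ⟹ `s + v₃(∏ c_ℓ) ≤ ∂⁽⁰⁾` at the optimal datum by the Manin-free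
bridge ⟹ with (DD) the conclusion.  No main conjecture, no Manin / `t` / `c₃` datum; the stub's degree-
minimality and plus-integrality binders are not used.  Residual of the stub = (DD), OPEN (Kim Conj. 1.10,
`≤` half, deep reading). [cite: Wuthrich2014, Prop. 21 (p. 400)] [cite: Kim2022StructureSelmer, Conj. 1.10 (PDF p. 8)] -/
theorem stub_nonAdditive_of_wuthrich_of_deepInfty_le_tamagawa (hW : sha_dvd_analyticSha)
    (hGZK : rank_eq_analyticRank_of_analyticRank_le_one) (hmod : hasEntireLFunction_rat) :
    ∀ (W₀ : WeierstrassCurve ℚ) [W₀.IsElliptic] [W₀.IsGloballyMinimal],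
      (∀ n : ℕ, W₀.HasSurjectiveModNGaloisRep (3 ^ n : ℕ)) → Finite W₀.sha →
      ∀ {N : ℕ} [NeZero N], N = W₀.conductorNorm ℤ →
      ∀ (D₀ : ModularParametrizationData W₀ N),
        (∀ z ∈ D₀.L.lattice, ∃ w ∈ periodLattice D₀.f, z = D₀.c * w) →
        (∀ (W₂ : WeierstrassCurve ℚ) [W₂.IsElliptic] (D₂ : ModularParametrizationData W₂ N),
          D₂.f = D₀.f → D₀.modularDegree ≤ D₂.modularDegree) →
        (∀ r : ℚ, ratPlusSymbol D₀.f r ≠ 0 → 0 ≤ padicValRat 3 (ratPlusSymbol D₀.f r)) →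
        kuriharaVanishingOrder W₀ 3 D₀.f = 0 →
        ¬ (haveI : Fact (Nat.Prime 3) := ⟨Nat.prime_three⟩; Addv W₀ 3) →
        -- (DD) at the row
        kuriharaPartialDeepInfty W₀ 3 D₀.f ≤ ((padicValNat 3 W₀.tamagawaProduct : ℕ) : ℕ∞) →
        ∃ d : ℕ, kuriharaPartialDeepInfty W₀ 3 D₀.f = d ∧
          ((padicValNat 3 (Nat.card (AddCommGroup.primaryComponent W₀.sha 3)) + d : ℕ) : ℕ∞) ≤
            kuriharaPartial W₀ 3 D₀.f 0 := by
  intro W₀ _ _ htower _ N _ _ D₀ hopt _ _ hord hnA hDD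
  haveI : Fact (Nat.Prime 3) := ⟨Nat.prime_three⟩
  have hsurj : W₀.HasSurjectiveModNGaloisRep 3 := by
    have h := htower 1
    rw [pow_one] at h
    exact h
  have hr0 : W₀.analyticRank = 0 :=
    analyticRank_eq_zero_of_kuriharaVanishingOrder_eq_zero W₀ D₀.f D₀.isNewformOf hord
  exact deepUpper_conclusion_of_sha_add_le_of_deepInfty_le W₀ 3 D₀.f
    (sha_add_tamagawa_le_kuriharaPartial_zero_of_missingUpperBoundAt_of_optimal W₀ 3 hGZK (by norm_num)
      (hasIrreducibleModPGaloisRep_of_hasSurjectiveModNGaloisRep W₀ 3 hsurj) D₀ hopt hord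
      (missingUpperBoundAt_three_of_not_addv_of_towerSurj hW hGZK hmod W₀ htower hr0 hnA)) hDD

/-- ★ **Crux `DeepUpperAtThreeOffKatoStratum` (item 19562) BY NAME from FOUR named facts and the two
residuals in their final form.**  Facts: Wuthrich 2014 Prop. 21 (`hW`), Kato Thm. 14.5 (3) Tamagawa-exact
(`hKato`), GZK (`hGZK`), modularity (`hmod`).  Residuals: (U′) Miller's upper half
`MissingUpperBoundAt W 3` on the ADDITIVE POTENTIALLY-MULTIPLICATIVE tower rows of analytic rank `0` with
`Ш` finite (no printed `Ш`-bound in the tree there); (DD) `∂^{(∞)}_{deep}(δ̃) ≤ v₃(∏ c_ℓ)` on the crux's rows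
(binders verbatim; OPEN).  Row by row `s + v₃(∏ c_ℓ) ≤ ∂⁽⁰⁾` at the optimal datum comes, Manin-free, from
`hW` (non-additive), `hKato` (additive potentially good) or (U′); (DD) closes.  The Kato-stratum exclusion
is not used. [cite: Wuthrich2014, Prop. 21 (p. 400)] [cite: Kato2004Asterisque, Thm. 14.5 (3) (p. 236), Prop. 14.16 (2) (p. 244)]
[cite: Miller2011LMS, Def. 1.1] [cite: Kim2022StructureSelmer, Conj. 1.10 (PDF p. 8)] [cite: Kim2025RefinedTNC, Thm. 1.1] -/
theorem deepUpperAtThreeOffKatoStratum_of_wuthrich_of_kato_of_residuals (hW : sha_dvd_analyticSha)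
    (hKato : Kato2004.rankZero_padicValNat_sha_add_padicValNat_tamagawa_le_of_additive_potGood_of_imageContainsSL2)
    (hGZK : rank_eq_analyticRank_of_analyticRank_le_one) (hmod : hasEntireLFunction_rat)
    (hU : ∀ (W : WeierstrassCurve ℚ) [W.IsElliptic] [W.IsGloballyMinimal],
      (∀ n : ℕ, W.HasSurjectiveModNGaloisRep (3 ^ n : ℕ)) → Finite W.sha → W.analyticRank = 0 →
      (haveI : Fact (Nat.Prime 3) := ⟨Nat.prime_three⟩; Addv W 3) → padicValRat 3 W.j < 0 →
      MissingUpperBoundAt W 3)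
    (hDD : ∀ (W₀ : WeierstrassCurve ℚ) [W₀.IsElliptic] [W₀.IsGloballyMinimal],
      (∀ n : ℕ, W₀.HasSurjectiveModNGaloisRep (3 ^ n : ℕ)) → Finite W₀.sha →
      ∀ {N : ℕ} [NeZero N], N = W₀.conductorNorm ℤ →
      ∀ (D₀ : ModularParametrizationData W₀ N),
        (∀ z ∈ D₀.L.lattice, ∃ w ∈ periodLattice D₀.f, z = D₀.c * w) →
        (∀ (W₂ : WeierstrassCurve ℚ) [W₂.IsElliptic] (D₂ : ModularParametrizationData W₂ N),
          D₂.f = D₀.f → D₀.modularDegree ≤ D₂.modularDegree) →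
        (∀ r : ℚ, ratPlusSymbol D₀.f r ≠ 0 → 0 ≤ padicValRat 3 (ratPlusSymbol D₀.f r)) →
        kuriharaVanishingOrder W₀ 3 D₀.f = 0 →
        ¬ ((haveI : Fact (Nat.Prime 3) := ⟨Nat.prime_three⟩; Addv W₀ 3) ∧
            ¬ 3 ∣ (W₀.baseChange ℚ_[3]).localTamagawaNumber ℤ_[3] ∧
            Nat.card {Q : (W₀.baseChange ℚ_[3]).toAffine.Point // (3 : ℕ) • Q = 0} = 1 ∧
            ¬ (3 : ℤ) ∣ D₀.maninConstant) →
        kuriharaPartialDeepInfty W₀ 3 D₀.f ≤ ((padicValNat 3 W₀.tamagawaProduct : ℕ) : ℕ∞)) :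
    DeepUpperAtThreeOffKatoStratum := by
  intro W₀ _ _ htower hfin N _ hN D₀ hopt hdeg hint hord hoff
  haveI : Fact (Nat.Prime 3) := ⟨Nat.prime_three⟩
  have hsurj : W₀.HasSurjectiveModNGaloisRep 3 := by
    have h := htower 1
    rw [pow_one] at h
    exact h
  have hirr : W₀.HasIrreducibleModPGaloisRep 3 :=
    hasIrreducibleModPGaloisRep_of_hasSurjectiveModNGaloisRep W₀ 3 hsurj
  have hr0 : W₀.analyticRank = 0 :=
    analyticRank_eq_zero_of_kuriharaVanishingOrder_eq_zero W₀ D₀.f D₀.isNewformOf hord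
  -- `s + v₃(∏ c_ℓ) ≤ ∂⁽⁰⁾` at the row
  have hK : ((padicValNat 3 (Nat.card (AddCommGroup.primaryComponent W₀.sha 3)) +
      padicValNat 3 W₀.tamagawaProduct : ℕ) : ℕ∞) ≤ kuriharaPartial W₀ 3 D₀.f 0 := by
    by_cases hnA : Addv W₀ 3
    · by_cases hpot : 0 ≤ padicValRat 3 W₀.j
      · exact sha_add_tamagawa_le_kuriharaPartial_zero_of_kato2004TamagawaExact_of_optimal W₀ hKato htower
          hfin D₀ hopt hord hnA hpot
      · exact sha_add_tamagawa_le_kuriharaPartial_zero_of_missingUpperBoundAt_of_optimal W₀ 3 hGZK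
          (by norm_num) hirr D₀ hopt hord (hU W₀ htower hfin hr0 hnA (lt_of_not_ge hpot))
    · exact sha_add_tamagawa_le_kuriharaPartial_zero_of_missingUpperBoundAt_of_optimal W₀ 3 hGZK
        (by norm_num) hirr D₀ hopt hord
        (missingUpperBoundAt_three_of_not_addv_of_towerSurj hW hGZK hmod W₀ htower hr0 hnA)
  exact deepUpper_conclusion_of_sha_add_le_of_deepInfty_le W₀ 3 D₀.f hK
    (hDD W₀ htower hfin hN D₀ hopt hdeg hint hord hoff)

end Summit.BirchSwinnertonDyer.BirchSwinnertonDyer.Theorems.KimAtThreeDeepUpperOffStratumWuthrich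

end
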